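import Literature.AnabelianGeometry.SemiGraphs.TemperedAnabelianMorphismsSchemaNegative
import HarnessLib

/-!
# [SemiAnbd] Thm. 6.8 (ii), equivalence clause, AS TYPED: the universal closure is FALSE over abstract
# `DLoc` data (schema verdict for FACT-LIST row F-1686)

Mochizuki, *Semi-graphs of anabelioids*, Publ. RIMS **42** (2006) [SemiAnbd], Thm. 6.8 (ii) p. 74:
"Every isomorphism of tempered groups `α : Π^temp_{X_K} ≅ Π^temp_{Y_L}` induces an equivalence of
categories `DLoc_{G_K}(Π^temp_{X_K}) ≅ DLoc_{G_L}(Π^temp_{Y_L})` …".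
[cite: MochizukiSemiAnbd2006, Thm 6.8(ii) p.74]

PROOF-ONLY file (abc-iut cell, F-TRANCHES tranche 169, prover abc-iut-f-169; no definition).  The
statements file `TemperedAnabelianMorphisms.lean` (abc-iut-L3-t4) types the equivalence clause of
Thm. 6.8 (ii) as the predicate `TemperedCurve.IsoInducesDLocEquivalence X Y DX DY α` over ABSTRACT
interface data: the two `DLoc` contexts `DX : DLocContext X`, `DY : DLocContext Y` each carry the
category structure on the group-theoretic objects `DLocObj X`, `DLocObj Y` as a FREE field `catG`.
The companion file `TemperedAnabelianMorphismsSchemaNegative.lean` (abc-iut-w5-d040, F-1681) left the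
universal closure of F-1686 open, observing that along `α = id` the identity equivalence transports
`(H, N)` in ANY category structure — which is correct when ONE context is used on both sides.  The
row's binder, however, quantifies `DX` and `DY` INDEPENDENTLY, and this file records the resulting
SCHEMA VERDICT:

* `not_forall_isoInducesDLocEquivalence` — at `X = Y := TemperedCurve.toyHyperbolic p` (abc-iut-w5-d040's
  non-degenerate toy, where `DLoc_{G_K}(Π^temp)` has TWO distinct objects, `DLocObj.exists_dLocObj_ne`),
  `α := id`, `DX` with the DISCRETE category structure on `DLocObj X` (a morphism `A ⟶ B` is a proof
  of `A = B`) and `DY` with the INDISCRETE one (every Hom a singleton), there is NO equivalence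
  `DLocObj X ≌ DLocObj X` between the two structures at all (`DLocObj.eq_of_equivalence_of_forall_hom`:
  an equivalence `E` gives a morphism `A₀ ⟶ E⁻¹(E A₀) ⟶ E⁻¹(E B) ⟶ B` in the discrete category, i.e.
  `A₀ = B`), so the typed clause fails.

Hence the universal closure `∀ X Y DX DY α, IsoInducesDLocEquivalence X Y DX DY α` is not a bindable
fact; only INSTANCE forms at genuine data are — and those are already PROVED in the tree and untouched
here: `DLocObj.isoInducesDLocEquivalence_of_thm65iii` (abc-iut-L3-t4, p412957: at the GENUINE category
`DLocObj.dlocCategory` on both sides, from Thm. 6.5 (iii)) and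
`TemperedCurve.isoInducesDLocEquivalence_toyHyperbolic_refl` (p418833, toy, `α = id`).  A refuted
universal closure over ABSTRACT data says only that the typed clause depends on the uncertified field
`catG`; nothing of [SemiAnbd] is refuted or asserted; no side is taken on [IUTchIII] Cor. 3.12.
-/

noncomputable section

namespace Literature.AnabelianGeometry.SemiGraphs

open CategoryTheory

universe v₁ v₂ u₁ u₂

variable {p : ℕ} [Fact p.Prime]

namespace DLocObj

/-- If every morphism of `C` forces equality of its source and target (e.g. `C` discrete) while `D`
has a morphism between any two objects (e.g. `D` indiscrete), then an equivalence `E : C ≌ D` forces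
any two objects `A₀`, `B` of `C` to be EQUAL: compose the unit `A₀ ⟶ E⁻¹(E A₀)`, the image under
`E⁻¹` of a morphism `E A₀ ⟶ E B`, and the inverse unit `E⁻¹(E B) ⟶ B`.  (The category-theoretic
core of the F-1686 schema verdict.) [cite: MochizukiSemiAnbd2006, Thm 6.8(ii) p.74] -/
theorem eq_of_equivalence_of_forall_hom {C : Type u₁} [Category.{v₁} C] {D : Type u₂}
    [Category.{v₂} D] (E : C ≌ D) (hC : ∀ ⦃A B : C⦄, (A ⟶ B) → A = B)
    (hD : ∀ A B : D, Nonempty (A ⟶ B)) (A₀ B : C) : A₀ = B :=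
  hC (E.unit.app A₀ ≫ E.inverse.map (hD (E.functor.obj A₀) (E.functor.obj B)).some ≫ E.unitInv.app B)

end DLocObj

namespace TemperedCurve

/-- **F-1686, schema verdict**: the equivalence clause of [SemiAnbd] Thm. 6.8 (ii) AS TYPED
(`IsoInducesDLocEquivalence X Y DX DY α`, over two INDEPENDENT abstract `DLoc` contexts whose category
structures on `DLocObj` are free fields) is NOT universally valid: at `X = Y := toyHyperbolic p`, `α := id`,
`DX` with the discrete and `DY` with the indiscrete category structure on `DLocObj X` (both over the toy
scheme side `ToyDLocK` with the constant "tempered fundamental group functor" at `DLocObj.toyHyperbolic`),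
no equivalence `DLocObj X ≌ DLocObj X` exists, because `DLocObj X` has two distinct objects
(`DLocObj.exists_dLocObj_ne`).  Instance forms at the genuine category
(`DLocObj.isoInducesDLocEquivalence_of_thm65iii`) and at the toy (`isoInducesDLocEquivalence_toyHyperbolic_refl`)
are untouched. [cite: MochizukiSemiAnbd2006, Thm 6.8(ii) p.74] -/
theorem not_forall_isoInducesDLocEquivalence (p : ℕ) [Fact p.Prime] :
    ¬ ∀ (X Y : TemperedCurve p) (DX : DLocContext X) (DY : DLocContext Y) (α : X.PiTemp ≃ₜ* Y.PiTemp),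
      Literature.AnabelianGeometry.SemiGraphs.TemperedCurve.IsoInducesDLocEquivalence X Y DX DY α := by
  intro h
  obtain ⟨B, hB⟩ := DLocObj.exists_dLocObj_ne (p := p)
  let X := TemperedCurve.toyHyperbolic p
  let A₀ : DLocObj X := DLocObj.toyHyperbolic p
  -- the two category structures on `DLocObj X` (kept as a pair: neither is registered as an instance)
  let cats : Category.{0} (DLocObj X) × Category.{0} (DLocObj X) :=
    ({ Hom := fun A B => PLift (A = B)
       id := fun A => ⟨rfl⟩
       comp := fun f g => ⟨f.down.trans g.down⟩
       id_comp := fun _ => rfl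
       comp_id := fun _ => rfl
       assoc := fun _ _ _ => rfl },
     { Hom := fun _ _ => PUnit
       id := fun _ => PUnit.unit
       comp := fun _ _ => PUnit.unit
       id_comp := fun _ => rfl
       comp_id := fun _ => rfl
       assoc := fun _ _ _ => rfl })
  -- the two contexts: same toy scheme side, discrete resp. indiscrete category structure on `DLocObj X`
  let DX : DLocContext X :=
    { DLocK := ToyDLocK
      self := ToyDLocK.self
      curve := fun _ => X
      pi1 := fun _ => ContinuousMonoidHom.id _
      selfIso := ContinuousMulEquiv.refl _
      catG := cats.1
      pi1Functor := @Functor.obj (DLocObj X) cats.1 (@Functor ToyDLocK _ (DLocObj X) cats.1)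
        (@Functor.category ToyDLocK _ (DLocObj X) cats.1) (@Functor.const ToyDLocK _ (DLocObj X) cats.1)
        A₀ }
  let DY : DLocContext X :=
    { DLocK := ToyDLocK
      self := ToyDLocK.self
      curve := fun _ => X
      pi1 := fun _ => ContinuousMonoidHom.id _
      selfIso := ContinuousMulEquiv.refl _
      catG := cats.2
      pi1Functor := @Functor.obj (DLocObj X) cats.2 (@Functor ToyDLocK _ (DLocObj X) cats.2)
        (@Functor.category ToyDLocK _ (DLocObj X) cats.2) (@Functor.const ToyDLocK _ (DLocObj X) cats.2)
        A₀ }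
  obtain ⟨E, -⟩ := h X X DX DY (ContinuousMulEquiv.refl _)
  refine hB.symm (@DLocObj.eq_of_equivalence_of_forall_hom (DLocObj X) cats.1 (DLocObj X) cats.2 E
    (fun A B' f => (f : PLift (A = B')).down) (fun _ _ => ⟨PUnit.unit⟩) A₀ B)

end TemperedCurve

end Literature.AnabelianGeometry.SemiGraphs

end
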